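import Summits.BirchSwinnertonDyer.Rank1Residual.X12.SpecialJIrreducible
import Literature.NumberTheory.EllipticCurves.GlobalMinimalModelProofs
import Literature.NumberTheory.EllipticCurves.OpenImageMazurAssemblyProofs
import HarnessLib

/-!
# `j ∈ {0, 1728}` ⟹ `E[p]` irreducible — model-free forms (any Weierstrass equation over `ℚ`)

HONEST FRAMING (cell `b2b-bsdres`, run/shared/lean/b2b/bsd-rank1-residual/, verbatim in every
file): the goal of the cell is to DELETE the COMBINATION-SHAPED residual classes of the
Birch–Swinnerton-Dyer formula for ALL analytic-rank `≤ 1` elliptic curves over `ℚ` — "full BSD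
formula for every rank `≤ 1` curve in class `C`" assembled STRICTLY from published theorems — so
that the rank-`≤ 1` remainder becomes exactly the CONSTRUCTION-SHAPED classes, which are TYPED
(missing-input `Prop`s), NOT attempted. This is not "finishing BSD". Harvest seat 1, generation 14.
Theorems only; nothing booked; no label moves.

`SpecialJIrreducible.lean` (p204456) proves `irr_of_j_eq_zero` / `irr_of_j_eq_1728` for a GLOBALLY
MINIMAL equation (the cell's census vocabulary). Irreducibility of `ρ̄_{E,p}` and the `j`-invariant
are both invariant under a change of Weierstrass equation (tree theorem
`Mazur1978.hasIrreducibleModPGaloisRep_smul_iff`, Silverman III.3.1(b); Mathlib `variableChange_j`), and every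
elliptic curve over `ℚ` has a global minimal model (tree theorem `hasGlobalMinimalModel_rat_holds`,
Néron / Silverman VIII.8.3), so the minimality instance can be dropped:

* `hasIrreducibleModPGaloisRep_of_j_eq_zero` — ANY elliptic `W/ℚ` with `j(W) = 0`, `p ≥ 5` prime
  ⟹ `W.HasIrreducibleModPGaloisRep p`;
* `hasIrreducibleModPGaloisRep_of_j_eq_1728` — ANY elliptic `W/ℚ` with `j(W) = 1728`, `p` odd.

References: B. Mazur, Invent. Math. 44 (1978) Prop. 6.3 (1) [Mazur1978]; K. Ireland, M. Rosen, GTM 84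
(1990) Ch. 18 Thm. 4 / Thm. 5 [IrelandRosen1990]; J. H. Silverman, *AEC* (2009) III.3.1(b),
VIII.8.3 [SilvermanAEC2009]; harvest-1 RECLASSIFY.md §GEN-14.
-/

set_option autoImplicit false

noncomputable section

open scoped Classical

open WeierstrassCurve Literature.NumberTheory.EllipticCurves

namespace Summit.BirchSwinnertonDyer.Rank1Residual.X12

/-- **Any elliptic curve over `ℚ` with `j = 0` has irreducible `E[p]` for every prime `p ≥ 5`**
(no minimality, no reduction hypothesis). [cite: Mazur1978, §6 Prop. 6.3 (1) (p. 153)] [cite: IrelandRosen1990, Ch. 18 §3, Theorem 4] [cite: SilvermanAEC2009, III.3.1(b) and VIII.8.3] -/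
theorem hasIrreducibleModPGaloisRep_of_j_eq_zero (W : WeierstrassCurve ℚ) [W.IsElliptic]
    (hj : W.j = 0) (p : ℕ) [Fact p.Prime] (hp5 : 5 ≤ p) : W.HasIrreducibleModPGaloisRep p := by
  obtain ⟨C, hC⟩ := hasGlobalMinimalModel_rat_holds W
  haveI := hC
  exact (Mazur1978.hasIrreducibleModPGaloisRep_smul_iff W C p).mp
    (irr_of_j_eq_zero (C • W) (by rw [variableChange_j, hj]) p hp5)

/-- **Any elliptic curve over `ℚ` with `j = 1728` has irreducible `E[p]` for every odd prime `p`**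
(no minimality, no reduction hypothesis). [cite: Mazur1978, §6 Prop. 6.3 (1) (p. 153)] [cite: IrelandRosen1990, Ch. 18 §4, Theorem 5 (first assertion)] [cite: SilvermanAEC2009, III.3.1(b) and VIII.8.3] -/
theorem hasIrreducibleModPGaloisRep_of_j_eq_1728 (W : WeierstrassCurve ℚ) [W.IsElliptic]
    (hj : W.j = 1728) (p : ℕ) [Fact p.Prime] (hp2 : p ≠ 2) : W.HasIrreducibleModPGaloisRep p := by
  obtain ⟨C, hC⟩ := hasGlobalMinimalModel_rat_holds W
  haveI := hC
  exact (Mazur1978.hasIrreducibleModPGaloisRep_smul_iff W C p).mp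
    (irr_of_j_eq_1728 (C • W) (by rw [variableChange_j, hj]) p hp2)

/-- Cell predicate form: `Irr W p` for ANY elliptic `W/ℚ` with `j = 0`, `p ≥ 5`. [cite: Mazur1978, §6 Prop. 6.3 (1) (p. 153)] -/
theorem irr_of_j_eq_zero_any (W : WeierstrassCurve ℚ) [W.IsElliptic] (hj : W.j = 0) (p : ℕ)
    [Fact p.Prime] (hp5 : 5 ≤ p) : Rank1Residual.Irr W p :=
  hasIrreducibleModPGaloisRep_of_j_eq_zero W hj p hp5

/-- Cell predicate form: `Irr W p` for ANY elliptic `W/ℚ` with `j = 1728`, `p` odd. [cite: Mazur1978, §6 Prop. 6.3 (1) (p. 153)] -/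
theorem irr_of_j_eq_1728_any (W : WeierstrassCurve ℚ) [W.IsElliptic] (hj : W.j = 1728) (p : ℕ)
    [Fact p.Prime] (hp2 : p ≠ 2) : Rank1Residual.Irr W p :=
  hasIrreducibleModPGaloisRep_of_j_eq_1728 W hj p hp2

end Summit.BirchSwinnertonDyer.Rank1Residual.X12

end
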